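import Summits.CriticalPhenomena.Ising3DConformalLimit.Theorems.LinkingParityCirclesSpinRatioMoebiusRatioLimitExistsOfCCI
import Summits.CriticalPhenomena.Ising3DConformalLimit.Theorems.LinkingParityCirclesSpinRatioMoebiusTwoPointPrelim
import Mathlib.Geometry.Euclidean.Inversion.Basic
import HarnessLib

/-!
# Crux `LinkingParityCircles.SpinRatioMoebius` (stmt-CriticalPhenomena-4530), line `registered` —
# stub `stub_ratioInversionOfCCI`: the inversion stub from the ratio limits and item stmt-CriticalPhenomena-4840

Write `Q^δ_m(x) = ⟨∏ᵢ σ_{[xᵢ/δ]}⟩ / ∏_{j<m} ⟨σ_{[x_j/δ]}σ_{[x_{m+j}/δ]}⟩` for the weight-free spin pairing ratio of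
critical 3D Ising at mesh `δ` and `ι = EuclideanGeometry.inversion 0 1` for the unit inversion.  Assume
(H7) iterated GKS II (`Q^δ_m ≥ 1` at injective lattice configurations), (H1) locally uniform limits `Q^δ_m → q_{2m}` on
the non-coincidence locus at every level, and item 4840 `CurrentConnectionInvariance.RatioInversionInvariance`
(`R^δ_n(ι∘z) − R^δ_n(z) → 0` for the telescoping ratios `R_n = G_n G_2 / G_{n+2}`).  Then
`Q^δ_m(ι∘x) − Q^δ_m(x) → 0` for every non-coincident `x` avoiding `0` (`stub_ratioInversionOfCCI`).

Proof: it suffices that the LIMITS agree, `q_{2m}(ι∘x) = q_{2m}(x)`, which is proved by induction on the level.  Levels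
`0` and `1` are trivial (the ratio is identically `1`).  For the step, with `y = x` minus its last pair and
`z = (y, x_m, x_{2m+1})`, the exact lattice identity `Q_{m+1}(x) = Q_m(y) / R_{2m}(z)` (`pairing_succ_eq`) and positivity
of all even critical correlators give `R_{2m}(z) = Q_m(y)/Q_{m+1}(x) → A/B` and `R_{2m}(ι∘z) → A/B'` pointwise along
`𝓝[>] 0` (`A = q_{2m}(y) = q_{2m}(ι∘y)` by the induction hypothesis, `B = q_{2m+2}(x)`, `B' = q_{2m+2}(ι∘x)`, all `≥ 1`
by (H7)), so item 4840 forces `A/B' = A/B`, i.e. `B' = B`.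

References: S. Friedli, Y. Velenik (CUP 2017) Thm. 3.20 (GKS); H. Duminil-Copin (2019) Thm. 4.8 (two-point positivity).
-/

noncomputable section

namespace Summit.CriticalPhenomena.Ising3DConformalLimit.Cruxes.SpinRatioMoebius.Birth

open Literature.Probability.LatticeModels Filter Set Metric Finset
open Summit.CriticalPhenomena.Ising3DConformalLimit.Cruxes.IsingEuclidUpgradeR4NonGaussian.FreeCovarianceDeltaDichotomy
  (criticalCorr_two_pos')
open scoped Topology


namespace RatioInversionOfCCI

/-! ## §A Pointwise limit algebra: cancelling a common positive limit -/

/-- **Limit cancellation.** If `Qx → B`, `Qx' → B'`, `Qy → A`, `Qy' → A` along a non-trivial filter, `Qx = Qy / R` and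
`Qx' = Qy' / R'` pointwise with `Qx, Qx'` nowhere zero, `A, B, B' > 0`, and `R' − R → 0`, then `B' = B`
(indeed `R → A/B` and `R' → A/B'`). [folklore] -/
theorem limit_cancel {l : Filter ℝ} [l.NeBot] {Qx Qx' Qy Qy' R R' : ℝ → ℝ} {A B B' : ℝ}
    (hB : Tendsto Qx l (𝓝 B)) (hB' : Tendsto Qx' l (𝓝 B')) (hA : Tendsto Qy l (𝓝 A))
    (hA' : Tendsto Qy' l (𝓝 A)) (hdiff : Tendsto (fun δ => R' δ - R δ) l (𝓝 0))
    (hid : ∀ δ, Qx δ = Qy δ / R δ) (hid' : ∀ δ, Qx' δ = Qy' δ / R' δ)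
    (hQ : ∀ δ, Qx δ ≠ 0) (hQ' : ∀ δ, Qx' δ ≠ 0) (h0A : 0 < A) (h0B : 0 < B) (h0B' : 0 < B') :
    B' = B := by
  have key : ∀ {Qx Qy R : ℝ → ℝ} {B : ℝ}, Tendsto Qx l (𝓝 B) → Tendsto Qy l (𝓝 A) →
      (∀ δ, Qx δ = Qy δ / R δ) → (∀ δ, Qx δ ≠ 0) → B ≠ 0 → Tendsto R l (𝓝 (A / B)) := by
    intro Qx Qy R B hB hA hid hQ hB0
    refine (hA.div hB hB0).congr fun δ => ?_
    have hR : R δ ≠ 0 := fun h => hQ δ (by rw [hid δ, h, div_zero])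
    rw [Pi.div_apply, div_eq_iff (hQ δ), hid δ, mul_div_cancel₀ _ hR]
  have h := tendsto_nhds_unique ((key hB' hA' hid' hQ' h0B'.ne').sub (key hB hA hid hQ h0B.ne')) hdiff
  rw [sub_eq_zero, div_eq_div_iff h0B'.ne' h0B.ne'] at h
  exact (mul_left_cancel₀ h0A.ne' h).symm

/-! ## §B Lattice facts: positivity and the GKS lower bound of the pairing ratio -/

/-- `Q^δ_m(x) > 0`: all even critical correlators of `ℤ³` are positive. [folklore] -/
theorem pairing_pos (m : ℕ) (δ : ℝ) (x : Fin (m + m) → EuclideanSpace ℝ (Fin 3)) :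
    0 < criticalCorr 3 (m + m) (fun i => latticeApprox δ (x i)) /
      ∏ j : Fin m, criticalCorr 3 2 ![latticeApprox δ (x (Fin.castAdd m j)), latticeApprox δ (x (Fin.natAdd m j))] :=
  div_pos (criticalCorr_pos_of_even ⟨m, rfl⟩ _) (Finset.prod_pos fun _ _ => criticalCorr_two_pos' _ _)

/-- (H7) at the eventually injective lattice images: `Q^δ_m(x) ≥ 1` eventually as `δ → 0⁺`, for `x` non-coincident.
[folklore] -/
theorem eventually_one_le_pairing
    (h7 : ∀ (m : ℕ) (y : Fin (m + m) → Site 3), Function.Injective y →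
      ∏ j : Fin m, criticalCorr 3 2 ![y (Fin.castAdd m j), y (Fin.natAdd m j)] ≤ criticalCorr 3 (m + m) y)
    {m : ℕ} {x : Fin (m + m) → EuclideanSpace ℝ (Fin 3)} (hx : x ∈ NonCoincident 3 (m + m)) :
    ∀ᶠ δ in 𝓝[>] (0:ℝ), (1:ℝ) ≤ criticalCorr 3 (m + m) (fun i => latticeApprox δ (x i)) /
      ∏ j : Fin m, criticalCorr 3 2 ![latticeApprox δ (x (Fin.castAdd m j)), latticeApprox δ (x (Fin.natAdd m j))] := by
  filter_upwards [eventually_injective_latticeApprox hx] with δ hδ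
  rw [le_div_iff₀ (Finset.prod_pos fun _ _ => criticalCorr_two_pos' _ _), one_mul]
  exact h7 m (fun i => latticeApprox δ (x i)) hδ

/-- Hence every locally uniform limit of `Q^δ_m` is `≥ 1` on the locus. [folklore] -/
theorem one_le_limit
    (h7 : ∀ (m : ℕ) (y : Fin (m + m) → Site 3), Function.Injective y →
      ∏ j : Fin m, criticalCorr 3 2 ![y (Fin.castAdd m j), y (Fin.natAdd m j)] ≤ criticalCorr 3 (m + m) y)
    {m : ℕ} {g : (Fin (m + m) → EuclideanSpace ℝ (Fin 3)) → ℝ}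
    (hg : TendstoLocallyUniformlyOn (fun (δ : ℝ) (x : Fin (m + m) → EuclideanSpace ℝ (Fin 3)) =>
      criticalCorr 3 (m + m) (fun i => latticeApprox δ (x i)) /
        ∏ j : Fin m, criticalCorr 3 2 ![latticeApprox δ (x (Fin.castAdd m j)), latticeApprox δ (x (Fin.natAdd m j))])
      g (𝓝[>] (0:ℝ)) (NonCoincident 3 (m + m)))
    {x : Fin (m + m) → EuclideanSpace ℝ (Fin 3)} (hx : x ∈ NonCoincident 3 (m + m)) : 1 ≤ g x :=
  ge_of_tendsto (hg.tendsto_at hx) (eventually_one_le_pairing h7 hx)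

/-! ## §C Levels `0` and `1`: the limits are identically `1` -/

/-- At level `0` every limit value on the locus is `1`. [folklore] -/
theorem limit_level_zero {g : (Fin (0 + 0) → EuclideanSpace ℝ (Fin 3)) → ℝ}
    (hg : TendstoLocallyUniformlyOn (fun (δ : ℝ) (x : Fin (0 + 0) → EuclideanSpace ℝ (Fin 3)) =>
      criticalCorr 3 (0 + 0) (fun i => latticeApprox δ (x i)) /
        ∏ j : Fin 0, criticalCorr 3 2 ![latticeApprox δ (x (Fin.castAdd 0 j)), latticeApprox δ (x (Fin.natAdd 0 j))])
      g (𝓝[>] (0:ℝ)) (NonCoincident 3 (0 + 0)))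
    {x : Fin (0 + 0) → EuclideanSpace ℝ (Fin 3)} (hx : x ∈ NonCoincident 3 (0 + 0)) : g x = 1 :=
  tendsto_nhds_unique (hg.tendsto_at hx) (tendsto_const_nhds.congr fun δ => (pairingRatio_level_zero δ x).symm)

/-- At level `1` every limit value on the locus is `1`. [folklore] -/
theorem limit_level_one {g : (Fin (1 + 1) → EuclideanSpace ℝ (Fin 3)) → ℝ}
    (hg : TendstoLocallyUniformlyOn (fun (δ : ℝ) (x : Fin (1 + 1) → EuclideanSpace ℝ (Fin 3)) =>
      criticalCorr 3 (1 + 1) (fun i => latticeApprox δ (x i)) /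
        ∏ j : Fin 1, criticalCorr 3 2 ![latticeApprox δ (x (Fin.castAdd 1 j)), latticeApprox δ (x (Fin.natAdd 1 j))])
      g (𝓝[>] (0:ℝ)) (NonCoincident 3 (1 + 1)))
    {x : Fin (1 + 1) → EuclideanSpace ℝ (Fin 3)} (hx : x ∈ NonCoincident 3 (1 + 1)) : g x = 1 :=
  tendsto_nhds_unique (hg.tendsto_at hx) (tendsto_const_nhds.congr fun δ => (pairingRatio_level_one δ x).symm)

/-! ## §D Configurations: inversion, dropping the last pair, reindexing -/

/-- `ι ∘ x` is non-coincident when `x` is (`ι` is injective). [folklore] -/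
theorem inversion_mem_nonCoincident {n : ℕ} {x : Fin n → EuclideanSpace ℝ (Fin 3)} (hx : x ∈ NonCoincident 3 n) :
    (fun i => EuclideanGeometry.inversion 0 1 (x i)) ∈ NonCoincident 3 n :=
  (mem_nonCoincident _).2
    ((EuclideanGeometry.inversion_injective _ one_ne_zero).comp ((mem_nonCoincident x).1 hx))

/-- The entries of `y(x)` (drop the last pair) are entries of `x`, hence avoid `0` when `x` does. [folklore] -/
theorem dropPair_ne_zero (m : ℕ) {x : Fin ((m + 1) + (m + 1)) → EuclideanSpace ℝ (Fin 3)} (hx0 : ∀ i, x i ≠ 0) :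
    ∀ i, (Fin.append (fun j : Fin m => x (Fin.castAdd (m + 1) (Fin.castSucc j)))
      (fun j : Fin m => x (Fin.natAdd (m + 1) (Fin.castSucc j))) : Fin (m + m) → EuclideanSpace ℝ (Fin 3)) i ≠ 0 := by
  intro i
  refine Fin.addCases (fun j => ?_) (fun j => ?_) i
  · simp only [Fin.append_left]; exact hx0 _
  · simp only [Fin.append_right]; exact hx0 _

/-- The entries of `z(x) = (y(x), x_m, x_{2m+1})` are entries of `x`, hence avoid `0` when `x` does. [folklore] -/
theorem reindex_ne_zero (m : ℕ) {x : Fin ((m + 1) + (m + 1)) → EuclideanSpace ℝ (Fin 3)} (hx0 : ∀ i, x i ≠ 0) :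
    ∀ i, (Fin.append (Fin.append (fun j : Fin m => x (Fin.castAdd (m + 1) (Fin.castSucc j)))
          (fun j : Fin m => x (Fin.natAdd (m + 1) (Fin.castSucc j))))
        ![x (Fin.castAdd (m + 1) (Fin.last m)), x (Fin.natAdd (m + 1) (Fin.last m))] :
        Fin ((m + m) + 2) → EuclideanSpace ℝ (Fin 3)) i ≠ 0 := by
  intro i
  refine Fin.addCases (fun j => ?_) (fun j => ?_) i
  · simp only [Fin.append_left]; exact dropPair_ne_zero m hx0 j
  · simp only [Fin.append_right]
    fin_cases j
    · exact hx0 _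
    · exact hx0 _

/-- `y(φ ∘ x) = φ ∘ y(x)` for any map `φ` of `ℝ³`. [folklore] -/
theorem dropPair_comp (m : ℕ) (φ : EuclideanSpace ℝ (Fin 3) → EuclideanSpace ℝ (Fin 3))
    (x : Fin ((m + 1) + (m + 1)) → EuclideanSpace ℝ (Fin 3)) :
    (Fin.append (fun j : Fin m => φ (x (Fin.castAdd (m + 1) (Fin.castSucc j))))
        (fun j : Fin m => φ (x (Fin.natAdd (m + 1) (Fin.castSucc j)))) : Fin (m + m) → EuclideanSpace ℝ (Fin 3)) =
      fun i => φ ((Fin.append (fun j : Fin m => x (Fin.castAdd (m + 1) (Fin.castSucc j)))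
        (fun j : Fin m => x (Fin.natAdd (m + 1) (Fin.castSucc j))) : Fin (m + m) → EuclideanSpace ℝ (Fin 3)) i) := by
  funext i
  refine Fin.addCases (fun j => ?_) (fun j => ?_) i <;> simp only [Fin.append_left, Fin.append_right]

/-- `z(φ ∘ x) = φ ∘ z(x)` for any map `φ` of `ℝ³`. [folklore] -/
theorem reindex_comp (m : ℕ) (φ : EuclideanSpace ℝ (Fin 3) → EuclideanSpace ℝ (Fin 3))
    (x : Fin ((m + 1) + (m + 1)) → EuclideanSpace ℝ (Fin 3)) :
    (Fin.append (Fin.append (fun j : Fin m => φ (x (Fin.castAdd (m + 1) (Fin.castSucc j))))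
          (fun j : Fin m => φ (x (Fin.natAdd (m + 1) (Fin.castSucc j)))))
        ![φ (x (Fin.castAdd (m + 1) (Fin.last m))), φ (x (Fin.natAdd (m + 1) (Fin.last m)))] :
        Fin ((m + m) + 2) → EuclideanSpace ℝ (Fin 3)) =
      fun i => φ ((Fin.append (Fin.append (fun j : Fin m => x (Fin.castAdd (m + 1) (Fin.castSucc j)))
          (fun j : Fin m => x (Fin.natAdd (m + 1) (Fin.castSucc j))))
        ![x (Fin.castAdd (m + 1) (Fin.last m)), x (Fin.natAdd (m + 1) (Fin.last m))] :
        Fin ((m + m) + 2) → EuclideanSpace ℝ (Fin 3)) i) := by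
  funext i
  refine Fin.addCases (fun j => ?_) (fun j => ?_) i
  · simp only [Fin.append_left]
    refine Fin.addCases (fun k => ?_) (fun k => ?_) j <;> simp only [Fin.append_left, Fin.append_right]
  · simp only [Fin.append_right]
    fin_cases j <;> rfl

/-! ## §E The induction step at the level of limits -/

/-- **Induction step.** If the level-`m` limits are `ι`-invariant on the locus (away from `0`), so are the
level-`(m+1)` limits: `Q_{m+1}(x) = Q_m(y)/R_{2m}(z)` exactly, limits `≥ 1`, and item 4840 at `z`. [folklore] -/
theorem step
    (h7 : ∀ (m : ℕ) (y : Fin (m + m) → Site 3), Function.Injective y →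
      ∏ j : Fin m, criticalCorr 3 2 ![y (Fin.castAdd m j), y (Fin.natAdd m j)] ≤ criticalCorr 3 (m + m) y)
    (hI : Summit.CriticalPhenomena.Ising3DConformalLimit.Theses.CurrentConnectionInvariance.RatioInversionInvariance)
    {q : CorrFamily 3}
    (hq : ∀ m : ℕ, TendstoLocallyUniformlyOn (fun (δ : ℝ) (x : Fin (m + m) → EuclideanSpace ℝ (Fin 3)) =>
      criticalCorr 3 (m + m) (fun i => latticeApprox δ (x i)) /
        ∏ j : Fin m, criticalCorr 3 2 ![latticeApprox δ (x (Fin.castAdd m j)), latticeApprox δ (x (Fin.natAdd m j))])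
      (q (m + m)) (𝓝[>] (0:ℝ)) (NonCoincident 3 (m + m)))
    {m : ℕ} (hm : 1 ≤ m)
    (ih : ∀ x ∈ NonCoincident 3 (m + m), (∀ i, x i ≠ 0) →
      q (m + m) (fun i => EuclideanGeometry.inversion 0 1 (x i)) = q (m + m) x)
    {x : Fin ((m + 1) + (m + 1)) → EuclideanSpace ℝ (Fin 3)} (hx : x ∈ NonCoincident 3 ((m + 1) + (m + 1)))
    (hx0 : ∀ i, x i ≠ 0) :
    q ((m + 1) + (m + 1)) (fun i => EuclideanGeometry.inversion 0 1 (x i)) = q ((m + 1) + (m + 1)) x := by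
  have hιx := inversion_mem_nonCoincident hx
  have hy : (Fin.append (fun j : Fin m => x (Fin.castAdd (m + 1) (Fin.castSucc j)))
      (fun j : Fin m => x (Fin.natAdd (m + 1) (Fin.castSucc j))) : Fin (m + m) → EuclideanSpace ℝ (Fin 3)) ∈
      NonCoincident 3 (m + m) :=
    dropPair_mapsTo m hx
  have hιy := inversion_mem_nonCoincident hy
  have hy0 := dropPair_ne_zero m hx0
  have hz : (Fin.append (Fin.append (fun j : Fin m => x (Fin.castAdd (m + 1) (Fin.castSucc j)))
          (fun j : Fin m => x (Fin.natAdd (m + 1) (Fin.castSucc j))))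
        ![x (Fin.castAdd (m + 1) (Fin.last m)), x (Fin.natAdd (m + 1) (Fin.last m))] :
        Fin ((m + m) + 2) → EuclideanSpace ℝ (Fin 3)) ∈ NonCoincident 3 ((m + m) + 2) :=
    reindex_mapsTo m hx
  have hz0 := reindex_ne_zero m hx0
  -- the four pairing-ratio limits and item 4840 at `z`
  have hA := (hq m).tendsto_at hy
  have hA' := (hq m).tendsto_at hιy
  rw [ih _ hy hy0] at hA'
  have hB := (hq (m + 1)).tendsto_at hx
  have hB' := (hq (m + 1)).tendsto_at hιx
  have hdiff := hI (m + m) ⟨m, rfl⟩ (by omega) _ hz hz0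
  refine limit_cancel hB hB' hA hA' hdiff (fun δ => pairing_succ_eq m δ x) (fun δ => ?_)
    (fun δ => (pairing_pos (m + 1) δ x).ne')
    (fun δ => (pairing_pos (m + 1) δ (fun i => EuclideanGeometry.inversion 0 1 (x i))).ne')
    (zero_lt_one.trans_le (one_le_limit h7 (hq m) hy)) (zero_lt_one.trans_le (one_le_limit h7 (hq (m + 1)) hx))
    (zero_lt_one.trans_le (one_le_limit h7 (hq (m + 1)) hιx))
  -- the exact identity at `ι ∘ x`, with `y(ι∘x) = ι∘y(x)` and `z(ι∘x) = ι∘z(x)`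
  have h := pairing_succ_eq m δ (fun i => EuclideanGeometry.inversion 0 1 (x i))
  rw [reindex_comp m _ x, dropPair_comp m _ x] at h
  exact h

end RatioInversionOfCCI

open RatioInversionOfCCI in
/-- **Registered stub `stub_ratioInversionOfCCI` of crux stmt-CriticalPhenomena-4530 (line `registered`).** Given the
iterated GKS bound (H7), locally uniform pairing-ratio limits at every level (H1) and item stmt-CriticalPhenomena-4840
`CurrentConnectionInvariance.RatioInversionInvariance`, the pairing ratios are asymptotically invariant under the unit
inversion: `Q^δ_m(ι∘x) − Q^δ_m(x) → 0` as `δ → 0⁺` for `x` non-coincident avoiding `0`. [folklore] -/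
theorem stub_ratioInversionOfCCI : (∀ (m : ℕ) (y : Fin (m + m) → Literature.Probability.LatticeModels.Site 3), Function.Injective y → ∏ j : Fin m, Literature.Probability.LatticeModels.criticalCorr 3 2 ![y (Fin.castAdd m j), y (Fin.natAdd m j)] ≤ Literature.Probability.LatticeModels.criticalCorr 3 (m + m) y) → (∃ q : Literature.Probability.LatticeModels.CorrFamily 3, ∀ m : ℕ, TendstoLocallyUniformlyOn (fun (δ : ℝ) (x : Fin (m + m) → EuclideanSpace ℝ (Fin 3)) => Literature.Probability.LatticeModels.criticalCorr 3 (m + m) (fun i => Literature.Probability.LatticeModels.latticeApprox δ (x i)) / ∏ j : Fin m, Literature.Probability.LatticeModels.criticalCorr 3 2 ![Literature.Probability.LatticeModels.latticeApprox δ (x (Fin.castAdd m j)), Literature.Probability.LatticeModels.latticeApprox δ (x (Fin.natAdd m j))]) (q (m + m)) (nhdsWithin 0 (Set.Ioi 0)) (Literature.Probability.LatticeModels.NonCoincident 3 (m + m))) → Summit.CriticalPhenomena.Ising3DConformalLimit.Theses.CurrentConnectionInvariance.RatioInversionInvariance → ∀ (m : ℕ), ∀ x ∈ Literature.Probability.LatticeModels.NonCoincident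 3 (m + m), (∀ i, x i ≠ 0) → Filter.Tendsto (fun δ : ℝ => Literature.Probability.LatticeModels.criticalCorr 3 (m + m) (fun i => Literature.Probability.LatticeModels.latticeApprox δ (EuclideanGeometry.inversion 0 1 (x i))) / (∏ j : Fin m, Literature.Probability.LatticeModels.criticalCorr 3 2 ![Literature.Probability.LatticeModels.latticeApprox δ (EuclideanGeometry.inversion 0 1 (x (Fin.castAdd m j))), Literature.Probability.LatticeModels.latticeApprox δ (EuclideanGeometry.inversion 0 1 (x (Fin.natAdd m j)))]) - Literature.Probability.LatticeModels.criticalCorr 3 (m + m) (fun i => Literature.Probability.LatticeModels.latticeApprox δ (x i)) / (∏ j : Fin m, Literature.Probability.LatticeModels.criticalCorr 3 2 ![Literature.Probability.LatticeModels.latticeApprox δ (x (Fin.castAdd m j)), Literature.Probability.LatticeModels.latticeApprox δ (x (Fin.natAdd m j))])) (nhdsWithin 0 (Set.Ioi 0)) (nhds 0) := by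
  intro h7 h1 hI
  obtain ⟨q, hq⟩ := h1
  -- the limits are `ι`-invariant on the locus away from `0`, by induction on the level
  have hP1 : ∀ m : ℕ, 1 ≤ m → ∀ x ∈ NonCoincident 3 (m + m), (∀ i, x i ≠ 0) →
      q (m + m) (fun i => EuclideanGeometry.inversion 0 1 (x i)) = q (m + m) x := by
    refine Nat.le_induction ?_ ?_
    · intro x hx _
      exact (limit_level_one (hq 1) (inversion_mem_nonCoincident hx)).trans (limit_level_one (hq 1) hx).symm
    · intro m hm ih x hx hx0
      exact step h7 hI hq hm ih hx hx0
  have hP : ∀ m : ℕ, ∀ x ∈ NonCoincident 3 (m + m), (∀ i, x i ≠ 0) →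
      q (m + m) (fun i => EuclideanGeometry.inversion 0 1 (x i)) = q (m + m) x := by
    intro m
    rcases Nat.eq_zero_or_pos m with rfl | hm
    · intro x hx _
      exact (limit_level_zero (hq 0) (inversion_mem_nonCoincident hx)).trans (limit_level_zero (hq 0) hx).symm
    · exact hP1 m hm
  intro m x hx hx0
  have h := ((hq m).tendsto_at (inversion_mem_nonCoincident hx)).sub ((hq m).tendsto_at hx)
  rw [hP m x hx hx0, sub_self] at h
  exact h

end Summit.CriticalPhenomena.Ising3DConformalLimit.Cruxes.SpinRatioMoebius.Birth

end
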